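import Mathlib
import Literature.Geometry.Lorentzian.ReggeWheelerTortoise
import Literature.Geometry.Lorentzian.ReggeWheelerChannels
import Summits.FinalStateConjecture.FinalStateConjecture.Theorems.PhotonSphereChannelsTortoiseFar
import Summits.FinalStateConjecture.FinalStateConjecture.Theorems.PhotonSphereChannelsUniformPhotonSphereChannelsRCoeffExists
import Summits.FinalStateConjecture.FinalStateConjecture.Theorems.PhotonSphereChannelsUniformPhotonSphereChannelsRSeriesChain
import Summits.FinalStateConjecture.FinalStateConjecture.Theorems.PhotonSphereChannelsUniformPhotonSphereChannelsRRecessiveUnique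
import Summits.FinalStateConjecture.FinalStateConjecture.Theorems.PhotonSphereChannelsUniformPhotonSphereChannelsRShiftFromCoeffs
import Summits.FinalStateConjecture.FinalStateConjecture.Theorems.PhotonSphereChannelsUniformPhotonSphereChannelsRResidualZero
import Summits.FinalStateConjecture.FinalStateConjecture.Theorems.PhotonSphereChannelsUniformPhotonSphereChannelsRResidualFromShift

/-!
# Crux `UniformPhotonSphereChannelsR` (K1R, stmt-FinalStateConjecture-14074), line
# `crum-peeling-recessive-tower` — closing chain 1/3: the peeled residual is sub-Hardy, GIVEN the
# coefficient majorant

This is the far-side ODE content `R` of the line (lead-0's `stub_residualSubHardy`, reshaped by the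
continuation leads c1/c2 into `R₀ ∧ R_D ∧ (R_D ⇒ R)` and `R_D` into five coefficient stubs), taken
from the line's published skeleton v4 (`Cruxes/UniformPhotonSphereChannelsR/Lines/
crum_peeling_recessive_tower.lean`, leads 0/c1/c2) and made to live in the tree: every stub it is
glued from is LANDED (`Theorems.CrumPeelingRecessiveTower.stub_{coeffExists, seriesChain,
recessiveUnique, shiftFromCoeffs, residualZero, residualFromShift}`) except the uniform coefficient
majorant `stub_coeffMajorant` (Theorem A), whose registered statement is therefore carried as the
HYPOTHESIS `hA` (verbatim).  Two theorems:

* `shiftBounds_of_coeffMajorant hA` — the registered v3 statement of `stub_shiftBounds` (R_D):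
  beyond `xc + ρ − 1` with `ρ ≥ 600KM + 1 + 600KM·log(ℓ+1)` the area radius exceeds `200RM`
  (`r ≥ 3M + (x − xc)/3`, `Theorems.tortoise_ge_third`), the coefficient arrays exist and are
  bounded by `R = K(1 + log(ℓ+1))` (`hA`), the analytic germs solve the chain there and coincide
  with the hypothesised recessive ladder, and the last rung's germ delivers the clauses;
* `residualSubHardy_of_coeffMajorant hA` — the registered v2 statement of `stub_residualSubHardy`
  (R): `ρ₂ = max ρ₃ ρ₄`, `C₂ = C₃`; `ℓ = 0` by `stub_residualZero`, `ℓ ≥ 1` by R_D and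
  `stub_residualFromShift`.

With Theorem A assembled in `…RCoeffMajorantAssembly.lean` (`coeffMajorant_of_rungStep`), the
hypothesis is discharged by `coeffMajorant_of_rungStep stub_convolutionBounds stub_rungStepMajorant`
once the rung step lands (or by any proof of `stub_coeffMajorant`).  Proof text: the skeleton's,
verbatim up to the threading of `hA` (credit: line leads 0, c1, c2).
-/

-- `Summit.<S>.<S>` repeats a namespace component by design (D-0017); off here as in the lakefile.
set_option linter.dupNamespace false

noncomputable section

namespace Summit.FinalStateConjecture.FinalStateConjecture.Theorems.UniformRClosing

open Literature.Geometry.Lorentzian Literature.Geometry.Lorentzian.ReggeWheeler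
open Summit.FinalStateConjecture.FinalStateConjecture.Theorems
open MeasureTheory Filter Set Topology
open scoped ENNReal

/-- **R_D from the coefficient majorant: the registered v3 signature of `stub_shiftBounds`, given
the statement of `stub_coeffMajorant` (`hA`) and the four landed coefficient stubs** — `ρ₃ = 600KM + 1`, `C₃ = 600KM` (`K` from `stub_coeffMajorant`): beyond `xc + ρ − 1` the area
radius exceeds `200RM` (`r ≥ 3M + (x − xc)/3`), the coefficient arrays exist (F) and are bounded (A), the
analytic germs solve the chain there (C₁) and coincide with the hypothesised ladder (C₂), and the last
rung's germ delivers the clauses (B) with `a′ = max a (xc + ρ − 1)`. -/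
theorem shiftBounds_of_coeffMajorant
    (hA : ∃ K : ℝ, 1 ≤ K ∧ ∀ (s ℓ : ℕ), s ≤ 2 → s ≤ ℓ → 1 ≤ ℓ → ∀ (Ω G : ℕ → ℕ → ℝ), (∀ k, Ω k 0 = 1) →
      (∀ k, G k 0 = 1) →
      (∀ k n, ∑ i ∈ Finset.range (n + 1), G k i * Ω k (n - i) = if n = 0 then 1 else 0) →
      (∀ n, (ℓ : ℝ) ^ 2 * ∑ i ∈ Finset.range (n + 1), Ω 0 i * Ω 0 (n - i) + (ℓ : ℝ) * (((n : ℝ) +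
      1) * Ω 0 n - 2 * (n : ℝ) * Ω 0 (n - 1)) = (if n = 0 then (ℓ : ℝ) * ((ℓ : ℝ) + 1) else if n =
      1 then 2 * (1 - (s : ℝ) ^ 2) - 2 * ((ℓ : ℝ) * ((ℓ : ℝ) + 1)) else if n = 2 then -(4 * (1 - (s
      : ℝ) ^ 2)) else 0)) →
      (∀ k, k + 2 ≤ ℓ →
      ∀ n, ((ℓ : ℝ) - k - 1) ^ 2 * ∑ i ∈ Finset.range (n + 1), Ω (k + 1) i * Ω (k + 1) (n - i) +
      ((ℓ : ℝ) - k - 1) * (((n : ℝ) + 1) * Ω (k + 1) n - 2 * (n : ℝ) * Ω (k + 1) (n - 1)) = ((ℓ :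
      ℝ) - k) ^ 2 * ∑ i ∈ Finset.range (n + 1), Ω k i * Ω k (n - i) - ((ℓ : ℝ) - k) * (((n : ℝ) +
      1) * Ω k n - 2 * (n : ℝ) * Ω k (n - 1))) →
      ∀ k, k + 1 ≤ ℓ → |G k 1| ≤ K * (1 + Real.log ((ℓ : ℝ) + 1)) ∧ (∀ n, 2 ≤ n →
      |G k n| ≤ (K * (1 + Real.log ((ℓ : ℝ) + 1))) ^ (n - 1)) ∧
      (∀ n, |Ω k n| ≤ (K * (1 + Real.log ((ℓ : ℝ) + 1))) ^ n)) :
    ∀ M : ℝ, 0 < M → ∃ ρ₃ : ℝ, 0 ≤ ρ₃ ∧ ∃ C₃ : ℝ, 0 ≤ C₃ ∧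
      ∀ (r : ℝ → ℝ) (xc : ℝ), IsTortoiseRadius M r xc → ∀ (s ℓ : ℕ), s ≤ 2 → s ≤ ℓ → 1 ≤ ℓ →
        ∀ ρ : ℝ, ρ₃ + C₃ * Real.log ((ℓ : ℝ) + 1) ≤ ρ →
          ∀ (W U : ℕ → ℝ → ℝ) (a : ℝ), a < xc + ρ →
            (∀ x, a < x → U 0 x = linePotential M s ℓ r x) →
            (∀ k, k < ℓ → ∀ x, a < x → HasDerivAt (W k) (U k x - W k x ^ 2) x) →
            (∀ k, k < ℓ → ∀ x, a < x → U (k + 1) x = 2 * W k x ^ 2 - U k x) →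
            (∀ k, k < ℓ → Tendsto (fun x => x * W k x) atTop (𝓝 ((k : ℝ) - ℓ))) →
            ∃ a' : ℝ, a ≤ a' ∧ a' < xc + ρ ∧
              (∀ x, a' < x → W (ℓ - 1) x < 0 ∧ U (ℓ - 1) x ≤ 2 * W (ℓ - 1) x ^ 2) ∧
              (∀ x, xc + ρ ≤ x →
                W (ℓ - 1) x ^ 2 ≤ 2 * (U (ℓ - 1) x - W (ℓ - 1) x ^ 2) ∧
                64 * (2 * W (ℓ - 1) x ^ 2 - U (ℓ - 1) x) ≤ W (ℓ - 1) x ^ 2) ∧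
              (∀ x, xc + ρ ≤ x → ∃ u' : ℝ, HasDerivAt (U (ℓ - 1)) u' x ∧
                4 * W (ℓ - 1) x * (U (ℓ - 1) x - W (ℓ - 1) x ^ 2) - u' ≤ 0) := by
  intro M hM
  obtain ⟨K, hK1, HA⟩ := hA
  have hK0 : 0 ≤ K := zero_le_one.trans hK1
  refine ⟨600 * K * M + 1, by positivity, 600 * K * M, by positivity, ?_⟩
  intro r xc hr s ℓ hs hsℓ hℓ ρ hρ W U a ha hL0 hL1 hL2 hL3
  -- the log factor and the radius `R`
  set Lg : ℝ := 1 + Real.log ((ℓ : ℝ) + 1) with hLg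
  have hlog : 0 ≤ Real.log ((ℓ : ℝ) + 1) :=
    Real.log_nonneg (by have : (0 : ℝ) ≤ ℓ := Nat.cast_nonneg ℓ; linarith)
  have hLg1 : 1 ≤ Lg := by rw [hLg]; linarith
  set R : ℝ := K * Lg with hRdef
  have hR1 : 1 ≤ R := by
    rw [hRdef]; nlinarith
  have hR0 : 0 ≤ R := zero_le_one.trans hR1
  -- the coefficient arrays and their bounds
  obtain ⟨Ω, G, hΩ0, hG0, hinv, hR0eq, hRKeq⟩ := CrumPeelingRecessiveTower.stub_coeffExists s ℓ hℓ
  have HB := HA s ℓ hs hsℓ hℓ Ω G hΩ0 hG0 hinv hR0eq hRKeq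
  have hΩbd : ∀ k, k + 1 ≤ ℓ → ∀ n, |Ω k n| ≤ R ^ n := fun k hk n => (HB k hk).2.2 n
  -- the threshold point `X = max a (xc + ρ − 1)` and the area radius beyond it
  have hρ1 : 600 * K * M * Lg + 1 ≤ ρ := by
    have : (600 * K * M + 1) + 600 * K * M * Real.log ((ℓ : ℝ) + 1) = 600 * K * M * Lg + 1 := by
      rw [hLg]; ring
    linarith
  set X : ℝ := max a (xc + ρ - 1) with hXdef
  have hXa : a ≤ X := le_max_left _ _
  have hXρ : X < xc + ρ := max_lt ha (by linarith)
  have hrX : ∀ x, X < x → 200 * R * M < r x := by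
    intro x hx
    have hx1 : xc + ρ - 1 < x := lt_of_le_of_lt (le_max_right _ _) hx
    have hKM : 0 ≤ 600 * K * M * Lg := by positivity
    have hxc : xc ≤ x := by linarith
    have h3 := tortoise_ge_third hr.mass_pos hr.two_mul_lt hr.hasDerivAt hr.center hxc
    have : 200 * R * M = (600 * K * M * Lg) / 3 := by rw [hRdef]; ring
    rw [this]
    have hM3 : 0 < 3 * M := by linarith [hr.mass_pos]
    linarith
  have hrX' : ∀ x, X < x → 2 * R * M < r x := fun x hx => by
    have := hrX x hx
    have : 0 ≤ R * M := mul_nonneg hR0 hM.le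
    linarith
  have haX : ∀ x, X < x → a < x := fun x hx => lt_of_le_of_lt hXa hx
  -- the analytic germs
  set Wa : ℕ → ℝ → ℝ := fun k x => -(((ℓ : ℝ) - k) / r x) * ∑' n, Ω k n * (M / r x) ^ n with hWadef
  have hWa : ∀ k x, Wa k x = -(((ℓ : ℝ) - k) / r x) * ∑' n, Ω k n * (M / r x) ^ n := fun k x => rfl
  obtain ⟨Ua, hUa0, hUas⟩ : ∃ Ua : ℕ → ℝ → ℝ, (∀ x, Ua 0 x = linePotential M s ℓ r x) ∧
      (∀ k x, Ua (k + 1) x = 2 * Wa k x ^ 2 - Ua k x) :=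
    ⟨fun k => Nat.rec (linePotential M s ℓ r) (fun j Uj => fun x => 2 * Wa j x ^ 2 - Uj x) k,
      fun x => rfl, fun k x => rfl⟩
  obtain ⟨hder, hlim⟩ :=
    CrumPeelingRecessiveTower.stub_seriesChain M r xc hr s ℓ Ω R hR1 hΩ0 hΩbd hR0eq hRKeq Wa Ua hWa hUa0 hUas
  -- identification of the hypothesised ladder with the germs on `(X, ∞)`
  have hid : ∀ k, k < ℓ → ∀ x, X < x → W k x = Wa k x ∧ U k x = Ua k x :=
    CrumPeelingRecessiveTower.stub_recessiveUnique ℓ (linePotential M s ℓ r) W U Wa Ua X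
      (fun x hx => hL0 x (haX x hx)) (fun x _ => hUa0 x)
      (fun k hk x hx => hL1 k hk x (haX x hx))
      (fun k hk x hx => hder k (by omega) x (hrX' x hx))
      (fun k hk x hx => hL2 k hk x (haX x hx)) (fun k _ x _ => hUas k x)
      hL3 (fun k hk => hlim k (by omega))
  -- the last rung
  have hℓ1 : ℓ - 1 < ℓ := by omega
  have hℓ1' : ℓ - 1 + 1 ≤ ℓ := by omega
  have hcast : ((ℓ : ℝ) - ((ℓ - 1 : ℕ) : ℝ)) = 1 := by
    rw [Nat.cast_sub hℓ]; push_cast; ring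
  obtain ⟨hG1, hGn, hΩn⟩ := HB (ℓ - 1) hℓ1'
  have hWser : ∀ x, X < x → W (ℓ - 1) x = -(1 / r x) * ∑' n, Ω (ℓ - 1) n * (M / r x) ^ n := by
    intro x hx
    rw [(hid (ℓ - 1) hℓ1 x hx).1, hWa, hcast]
  have HBx := CrumPeelingRecessiveTower.stub_shiftFromCoeffs M R r xc hr hR1 (G (ℓ - 1)) (Ω (ℓ - 1)) (hG0 _) (hΩ0 _) hG1 hGn
    hΩn (hinv (ℓ - 1)) (W (ℓ - 1)) (U (ℓ - 1)) X (fun x hx => (hrX x hx).le) hWser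
    (fun x hx => hL1 (ℓ - 1) hℓ1 x (haX x hx))
  refine ⟨X, hXa, hXρ, fun x hx => ⟨(HBx x hx).1, (HBx x hx).2.1⟩, fun x hx => ?_, fun x hx => ?_⟩
  · have hx' : X < x := lt_of_lt_of_le hXρ hx
    exact ⟨(HBx x hx').2.2.1, (HBx x hx').2.2.2.1⟩
  · have hx' : X < x := lt_of_lt_of_le hXρ hx
    exact (HBx x hx').2.2.2.2

/-- **R from the coefficient majorant: the registered v2 signature of `stub_residualSubHardy` from
R₀ (landed), R_D (`shiftBounds_of_coeffMajorant hA`) and R_D ⇒ R (landed)** — `ρ₂ = max ρ₃ ρ₄`, `C₂ = C₃`; for `ℓ = 0` (forcing `s = 0`, and `log 1 = 0`) use R₀, for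
`ℓ ≥ 1` feed R_D's bounds at `x_f = xc + ρ` into the reduction. -/
theorem residualSubHardy_of_coeffMajorant
    (hA : ∃ K : ℝ, 1 ≤ K ∧ ∀ (s ℓ : ℕ), s ≤ 2 → s ≤ ℓ → 1 ≤ ℓ → ∀ (Ω G : ℕ → ℕ → ℝ), (∀ k, Ω k 0 = 1) →
      (∀ k, G k 0 = 1) →
      (∀ k n, ∑ i ∈ Finset.range (n + 1), G k i * Ω k (n - i) = if n = 0 then 1 else 0) →
      (∀ n, (ℓ : ℝ) ^ 2 * ∑ i ∈ Finset.range (n + 1), Ω 0 i * Ω 0 (n - i) + (ℓ : ℝ) * (((n : ℝ) +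
      1) * Ω 0 n - 2 * (n : ℝ) * Ω 0 (n - 1)) = (if n = 0 then (ℓ : ℝ) * ((ℓ : ℝ) + 1) else if n =
      1 then 2 * (1 - (s : ℝ) ^ 2) - 2 * ((ℓ : ℝ) * ((ℓ : ℝ) + 1)) else if n = 2 then -(4 * (1 - (s
      : ℝ) ^ 2)) else 0)) →
      (∀ k, k + 2 ≤ ℓ →
      ∀ n, ((ℓ : ℝ) - k - 1) ^ 2 * ∑ i ∈ Finset.range (n + 1), Ω (k + 1) i * Ω (k + 1) (n - i) +
      ((ℓ : ℝ) - k - 1) * (((n : ℝ) + 1) * Ω (k + 1) n - 2 * (n : ℝ) * Ω (k + 1) (n - 1)) = ((ℓ :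
      ℝ) - k) ^ 2 * ∑ i ∈ Finset.range (n + 1), Ω k i * Ω k (n - i) - ((ℓ : ℝ) - k) * (((n : ℝ) +
      1) * Ω k n - 2 * (n : ℝ) * Ω k (n - 1))) →
      ∀ k, k + 1 ≤ ℓ → |G k 1| ≤ K * (1 + Real.log ((ℓ : ℝ) + 1)) ∧ (∀ n, 2 ≤ n →
      |G k n| ≤ (K * (1 + Real.log ((ℓ : ℝ) + 1))) ^ (n - 1)) ∧
      (∀ n, |Ω k n| ≤ (K * (1 + Real.log ((ℓ : ℝ) + 1))) ^ n)) :
    ∀ M : ℝ, 0 < M → ∃ ρ₂ : ℝ, 0 ≤ ρ₂ ∧ ∃ C₂ : ℝ, 0 ≤ C₂ ∧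
      ∀ (r : ℝ → ℝ) (xc : ℝ), IsTortoiseRadius M r xc → ∀ (s ℓ : ℕ), s ≤ 2 → s ≤ ℓ →
        ∀ ρ : ℝ, ρ₂ + C₂ * Real.log ((ℓ : ℝ) + 1) ≤ ρ →
          ∀ (W U : ℕ → ℝ → ℝ) (a : ℝ), a < xc + ρ →
            (∀ x, a < x → U 0 x = linePotential M s ℓ r x) →
            (∀ k, k < ℓ → ∀ x, a < x → HasDerivAt (W k) (U k x - W k x ^ 2) x) →
            (∀ k, k < ℓ → ∀ x, a < x → U (k + 1) x = 2 * W k x ^ 2 - U k x) →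
            (∀ k, k < ℓ → Tendsto (fun x => x * W k x) atTop (𝓝 ((k : ℝ) - ℓ))) →
            (∃ a' : ℝ, a ≤ a' ∧ a' < xc + ρ ∧ ∀ x, a' < x → 0 ≤ U ℓ x) ∧
            AntitoneOn (U ℓ) (Set.Ici (xc + ρ)) ∧
            ∀ t : ℝ, 0 < t → t ^ 2 * U ℓ (xc + ρ + t) ≤ 1 / 16 := by
  intro M hM
  obtain ⟨ρ₄, hρ₄, HZ⟩ := CrumPeelingRecessiveTower.stub_residualZero M hM
  obtain ⟨ρ₃, hρ₃, C₃, hC₃, HD⟩ := shiftBounds_of_coeffMajorant hA M hM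
  refine ⟨max ρ₃ ρ₄, hρ₃.trans (le_max_left _ _), C₃, hC₃, ?_⟩
  intro r xc hr s ℓ hs hsℓ ρ hρ W U a ha hL0 hL1 hL2 hL3
  have hlog : 0 ≤ Real.log ((ℓ : ℝ) + 1) := by
    apply Real.log_nonneg
    have : (0 : ℝ) ≤ ℓ := Nat.cast_nonneg ℓ
    linarith
  rcases Nat.eq_zero_or_pos ℓ with h0 | hpos
  · -- ℓ = 0: no rung, `s = 0`
    subst h0
    obtain rfl : s = 0 := Nat.le_zero.mp hsℓ
    have hρ4 : ρ₄ ≤ ρ := by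
      have h1 : ρ₄ ≤ max ρ₃ ρ₄ := le_max_right _ _
      have h2 : 0 ≤ C₃ * Real.log (((0 : ℕ) : ℝ) + 1) := mul_nonneg hC₃ hlog
      linarith
    exact HZ r xc hr ρ hρ4 U a ha hL0
  · -- ℓ ≥ 1: shift bounds, then the reduction
    have hρ3 : ρ₃ + C₃ * Real.log ((ℓ : ℝ) + 1) ≤ ρ := by
      have h1 : ρ₃ ≤ max ρ₃ ρ₄ := le_max_left _ _
      linarith
    obtain ⟨a', haa', ha', H12, H3, H4⟩ :=
      HD r xc hr s ℓ hs hsℓ hpos ρ hρ3 W U a ha hL0 hL1 hL2 hL3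
    have hW : ∀ x, a < x → HasDerivAt (W (ℓ - 1)) (U (ℓ - 1) x - W (ℓ - 1) x ^ 2) x :=
      hL1 (ℓ - 1) (by omega)
    have hU : ∀ x, a < x → U ℓ x = 2 * W (ℓ - 1) x ^ 2 - U (ℓ - 1) x := by
      intro x hx
      have h := hL2 (ℓ - 1) (by omega) x hx
      rwa [Nat.sub_add_cancel hpos] at h
    exact CrumPeelingRecessiveTower.stub_residualFromShift W U ℓ a a' (xc + ρ) hpos haa' ha' hW hU H12 H3 H4

end Summit.FinalStateConjecture.FinalStateConjecture.Theorems.UniformRClosing
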